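import Literature.Analysis.PDE.LoewnerNirenbergMaximal
import Mathlib.Topology.Metrizable.Basic
import Mathlib.Data.Nat.Pairing
import HarnessLib

/-!
# The maximal solution of the Loewner–Nirenberg equation by Perron's method

Sorry-free ASSEMBLY of the named fact `LoewnerNirenberg.exists_isMaximalSolution` (F1 of
`LoewnerNirenbergFacts.lean`: every domain `Ω ⊆ ℝⁿ`, `n ≥ 3`, with `ℝⁿ ∖ Ω̄ ≠ ∅` carries a positive
maximal solution of `Δu = ¼n(n-2)u^{(n+2)/(n-2)}`; Loewner–Nirenberg 1974, González–Li–Nguyen 2018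
Def. 4.1) from the two LOCAL analytic inputs of Perron's method, which enter as HYPOTHESES of the
theorems of this file (they are being proved from the Poisson operator of the ball and the
Newtonian potential, `PoissonBall.lean`, `NewtonianPotentialRegularity.lean`):

* `(S)` **local solvability** — for every centre `c` and levels `0 < δ ≤ M` there is `r₁ > 0` such
  that on every ball `B(c, r)`, `0 < r ≤ r₁`, the Dirichlet problem `Δz = f_n(z)` in `B(c, r)`,
  `z = φ` on `∂B(c, r)` has a solution continuous on `B̄(c, r)` for all continuous data
  `δ ≤ φ ≤ M` (González–Li–Nguyen 2018, Thm. 1.1 on small balls; classically by contraction);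
* `(K)` **compactness** — on a ball `B(c, r)`, the pointwise limit of a non-decreasing sequence of
  solutions with values in `[δ, M]`, `δ > 0`, is a solution on every smaller concentric ball
  (interior estimates; González–Li–Nguyen 2018, Thm. 3.5 and the "standard argument" after
  Def. 4.1, Loewner–Nirenberg 1974 §3).

From `(S)` and `(K)` we PROVE (`isSolution_loewnerNirenberg_of_perron`,
`exists_isMaximalSolution_of_perron`) that `u_Ω = loewnerNirenberg Ω` solves the equation on
every open `Ω` with `ℝⁿ ∖ Ω̄ ≠ ∅`, hence F1 (by `exists_isMaximalSolution_iff` of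
`LoewnerNirenbergMaximal.lean`).  The argument is Perron's method run INSIDE the class of
classical solutions (González–Li–Nguyen 2018, proof of Thm. 1.1, Step 1, "the standard Perron
method", here for `k = 1` and classical solutions):

* the PERRON CLASS `IsPerron Ω v₀ v` of a floor `v₀` (a fixed positive solution on `Ω`, the
  exterior-ball solution `u^{(out)}` of Lemma 3.2): `v` continuous on `Ω`, `v ≥ v₀`, and `v` obeys
  comparison under solutions on closed balls `B̄ ⊆ Ω` (`v ≤ z` on `∂B` ⇒ `v ≤ z` in `B` for every
  solution `z` in `B` continuous on `B̄`); it contains `max(w, v₀)` for every solution `w`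
  (`isPerron_max_of_isSolution`, by the comparison principle Prop. 2.2, `comparison`), is closed
  under `max` (`IsPerron.sup`) and under the Perron LIFTING on balls (`IsPerron.lift`: replace `v`
  inside `B` by the solution of `(S)` with data `v|∂B`), and is locally uniformly bounded by the
  ball solutions of Lemma 3.1 (`IsPerron.le_ballProfile`, `IsPerron.le_levelBound`);
* the PERRON FUNCTION `perron Ω v₀ = sup` of the class is a solution (`isSolution_perron`): near
  `x₀`, lift a non-decreasing sequence of the class exhausting the supremum on a countable dense
  set `D` of a small ball `B`; by `(K)` the lifted solutions converge to a solution `Z ≤ perron`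
  with `Z = perron` on `D`; for any other member `v`, the same construction with `max(·, v)` gives
  a solution `Z' ≥ Z`, `Z' ≥ v`, again `= perron` on `D`, so `Z = Z'` on the half ball by DENSITY
  and continuity (no strong maximum principle is needed), whence `v ≤ Z` and `perron = Z`;
* `perron Ω v₀` dominates every solution, so it is `u_Ω`, which therefore solves the equation.

## References

* M. d. M. González, Y. Y. Li, L. Nguyen, *Existence and uniqueness to a fully nonlinear version
  of the Loewner–Nirenberg problem*, Commun. Math. Stat. 6 (2018) 269–288, arXiv:1804.08851:
  Prop. 2.2, Lemma 3.1, Lemma 3.2, proof of Thm. 1.1 (Step 1, Perron's method), Def. 4.1.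
  [GonzalezLiNguyen2018]
* C. Loewner, L. Nirenberg, *Partial differential equations invariant under conformal or
  projective transformations*, Contributions to Analysis, Academic Press (1974), 245–272.
  [LoewnerNirenberg1974]
* D. Gilbarg, N. S. Trudinger, *Elliptic Partial Differential Equations of Second Order*
  (Springer 2001), §2.8 (the method of subharmonic functions), §6.3. [GilbargTrudinger2001]
-/

noncomputable section

open Set Filter Metric Module TopologicalSpace Bornology
open scoped Laplacian Topology ContDiff Classical

namespace Literature.Analysis.PDE

namespace LoewnerNirenberg

variable {E : Type*} [NormedAddCommGroup E] [InnerProductSpace ℝ E] [FiniteDimensional ℝ E]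

/-! ### Comparison of solutions continuous up to the sphere -/

section BallComparison

variable {c : E} {r : ℝ} {z₁ z₂ : E → ℝ}

/-- **Comparison on a ball, data attained continuously**: two solutions on `B(c, r)`, continuous
on `B̄(c, r)` and ordered on the sphere, are ordered on the ball (Prop. 2.2 with
`limsup (z₁ - z₂) ≤ 0` at `∂B` supplied by continuity). [cite: GonzalezLiNguyen2018, Prop. 2.2] -/
theorem IsSolution.le_of_sphere (hn : 3 ≤ finrank ℝ E) (hr : 0 < r)
    (h₁ : IsSolution (ball c r) z₁) (h₂ : IsSolution (ball c r) z₂)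
    (hc₁ : ContinuousOn z₁ (closedBall c r)) (hc₂ : ContinuousOn z₂ (closedBall c r))
    (hle : ∀ y ∈ sphere c r, z₁ y ≤ z₂ y) : ∀ y ∈ ball c r, z₁ y ≤ z₂ y := by
  refine comparison hn isOpen_ball isBounded_ball h₁.isSubsolution h₂.contDiffOn
    (fun x hx => h₂.nonneg hx) (fun x hx => (h₂.laplacian_eq hx).le) fun ζ hζ ε hε => ?_
  rw [frontier_ball c hr.ne'] at hζ
  have hζc : ζ ∈ closedBall c r := sphere_subset_closedBall hζ
  have ht : Tendsto (fun x => z₁ x - z₂ x) (𝓝[ball c r] ζ) (𝓝 (z₁ ζ - z₂ ζ)) :=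
    ((hc₁ ζ hζc).sub (hc₂ ζ hζc)).tendsto.mono_left (nhdsWithin_mono ζ ball_subset_closedBall)
  have hlt : z₁ ζ - z₂ ζ < ε := by linarith [hle ζ hζ]
  exact (ht.eventually_lt_const hlt).mono fun x hx => by linarith

end BallComparison

/-! ### The Perron class of a floor `v₀` -/

section PerronClass

variable {Ω : Set E} {v₀ v w : E → ℝ} {x : E}

/-- **The Perron class** of the open set `Ω` relative to the floor `v₀` (a fixed solution on `Ω`):
`v` is continuous on `Ω`, `v ≥ v₀` on `Ω`, and `v` obeys COMPARISON UNDER SOLUTIONS ON CLOSED BALLS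
inside `Ω`: for every `B̄(c, r) ⊆ Ω` and every solution `z` on `B(c, r)` continuous on `B̄(c, r)`,
`v ≤ z` on `∂B(c, r)` implies `v ≤ z` on `B(c, r)` (the continuous subsolutions of Perron's
method; González–Li–Nguyen 2018, proof of Thm. 1.1, Step 1; Gilbarg–Trudinger §2.8, §6.3).
[cite: GonzalezLiNguyen2018, proof of Thm. 1.1 (Step 1)] -/
structure IsPerron (Ω : Set E) (v₀ v : E → ℝ) : Prop where
  continuousOn : ContinuousOn v Ω
  floor_le : ∀ ⦃x⦄, x ∈ Ω → v₀ x ≤ v x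
  le_of_sphere : ∀ ⦃c : E⦄ ⦃r : ℝ⦄, 0 < r → closedBall c r ⊆ Ω → ∀ ⦃z : E → ℝ⦄,
    ContinuousOn z (closedBall c r) → IsSolution (ball c r) z → (∀ y ∈ sphere c r, v y ≤ z y) →
    ∀ y ∈ ball c r, v y ≤ z y

/-- A solution on an open `Ω` obeys comparison under solutions on closed balls inside `Ω`
(Prop. 2.2). [cite: GonzalezLiNguyen2018, Prop. 2.2] -/
theorem IsSolution.le_of_sphere_of_closedBall_subset (hn : 3 ≤ finrank ℝ E)
    (hw : IsSolution Ω w) {c : E} {r : ℝ} (hr : 0 < r) (hsub : closedBall c r ⊆ Ω) {z : E → ℝ}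
    (hzc : ContinuousOn z (closedBall c r)) (hz : IsSolution (ball c r) z)
    (hle : ∀ y ∈ sphere c r, w y ≤ z y) : ∀ y ∈ ball c r, w y ≤ z y :=
  (hw.mono (ball_subset_closedBall.trans hsub)).le_of_sphere hn hr hz
    (hw.contDiffOn.continuousOn.mono hsub) hzc hle

/-- **`max(w, v₀)` is in the Perron class** for every solution `w` on the open set `Ω` (and the
floor solution `v₀`). [cite: GonzalezLiNguyen2018, proof of Thm. 1.1 (Step 1)] -/
theorem isPerron_max_of_isSolution (hn : 3 ≤ finrank ℝ E) (hv₀ : IsSolution Ω v₀)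
    (hw : IsSolution Ω w) : IsPerron Ω v₀ fun x => max (w x) (v₀ x) where
  continuousOn := hw.contDiffOn.continuousOn.sup hv₀.contDiffOn.continuousOn
  floor_le := fun _ _ => le_max_right _ _
  le_of_sphere := fun _ _ hr hsub _ hzc hz hle y hy =>
    max_le (hw.le_of_sphere_of_closedBall_subset hn hr hsub hzc hz
        (fun y hy => (le_max_left _ _).trans (hle y hy)) y hy)
      (hv₀.le_of_sphere_of_closedBall_subset hn hr hsub hzc hz
        (fun y hy => (le_max_right _ _).trans (hle y hy)) y hy)

/-- The floor solution itself is in its Perron class. [folklore] -/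
theorem isPerron_floor (hn : 3 ≤ finrank ℝ E) (hv₀ : IsSolution Ω v₀) : IsPerron Ω v₀ v₀ := by
  simpa only [max_self] using isPerron_max_of_isSolution hn hv₀ hv₀

/-- **The Perron class is closed under `max`.** [cite: GonzalezLiNguyen2018, proof of Thm. 1.1
(Step 1)] -/
theorem IsPerron.sup (hv : IsPerron Ω v₀ v) (hw : IsPerron Ω v₀ w) :
    IsPerron Ω v₀ fun x => max (v x) (w x) where
  continuousOn := hv.continuousOn.sup hw.continuousOn
  floor_le := fun _ hx => (hv.floor_le hx).trans (le_max_left _ _)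
  le_of_sphere := fun _ _ hr hsub _ hzc hz hle y hy =>
    max_le (hv.le_of_sphere hr hsub hzc hz (fun y hy => (le_max_left _ _).trans (hle y hy)) y hy)
      (hw.le_of_sphere hr hsub hzc hz (fun y hy => (le_max_right _ _).trans (hle y hy)) y hy)

/-! ### Local bounds: comparison with the ball solutions (Lemma 3.1) -/

/-- **Members of the Perron class lie below the ball solution** `u^{(in)}_{ρ,c}` on every
`B(c, ρ)` with `B̄(c, ρ) ⊆ Ω` (Lemma 3.1 for the Perron class: compare on `B̄(c, s)`, `s ↑ ρ`,
where the profile exceeds `max_{B̄(c,ρ)} v` on `∂B(c, s)`). [cite: GonzalezLiNguyen2018, Lemma 3.1] -/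
theorem IsPerron.le_ballProfile (hn : 3 ≤ finrank ℝ E) (hv : IsPerron Ω v₀ v) {c : E} {ρ : ℝ}
    (hρ : 0 < ρ) (hsub : closedBall c ρ ⊆ Ω) : ∀ y ∈ ball c ρ, v y ≤ ballProfile c ρ y := by
  intro y hy
  -- a bound `K` of `v` on the compact `B̄(c, ρ)`
  obtain ⟨K, hK⟩ : ∃ K, ∀ x ∈ closedBall c ρ, v x ≤ K := by
    obtain ⟨K, hK⟩ := (isCompact_closedBall c ρ).bddAbove_image (hv.continuousOn.mono hsub)
    exact ⟨K, fun x hx => hK (mem_image_of_mem v hx)⟩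
  set k : ℝ := ((finrank ℝ E : ℝ) - 2) / 2 with hk
  have hk0 : 0 < k := by
    have : (3 : ℝ) ≤ finrank ℝ E := by exact_mod_cast hn
    rw [hk]; linarith
  -- the profile on `∂B(c, s)`, `(2ρ/(ρ² - s²))^k`, tends to `+∞` as `s ↑ ρ`
  have htend : Tendsto (fun s : ℝ => (2 * ρ / (ρ ^ 2 - s ^ 2)) ^ k) (𝓝[<] ρ) atTop := by
    have hden : Tendsto (fun s : ℝ => ρ ^ 2 - s ^ 2) (𝓝[<] ρ) (𝓝[>] 0) := by
      refine tendsto_nhdsWithin_iff.2 ⟨?_, ?_⟩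
      · have hc : Continuous fun s : ℝ => ρ ^ 2 - s ^ 2 := by fun_prop
        simpa using (hc.tendsto ρ).mono_left nhdsWithin_le_nhds
      · filter_upwards [Ioo_mem_nhdsLT hρ] with s hs
        have h1 : s ^ 2 < ρ ^ 2 := pow_lt_pow_left₀ hs.2 hs.1.le two_ne_zero
        show 0 < ρ ^ 2 - s ^ 2
        linarith
    simp only [div_eq_mul_inv]
    exact (tendsto_rpow_atTop hk0).comp
      ((tendsto_inv_nhdsGT_zero.comp hden).const_mul_atTop (by linarith))
  have hy' : ‖y - c‖ < ρ := by rwa [mem_ball, dist_eq_norm] at hy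
  have hev : ∀ᶠ s in 𝓝[<] ρ, s ∈ Ioo ‖y - c‖ ρ := Ioo_mem_nhdsLT hy'
  obtain ⟨s, ⟨hys, hsρ⟩, hKs⟩ : ∃ s, s ∈ Ioo ‖y - c‖ ρ ∧ K ≤ (2 * ρ / (ρ ^ 2 - s ^ 2)) ^ k :=
    (hev.and (htend.eventually_ge_atTop K)).exists
  have hs0 : 0 < s := (norm_nonneg _).trans_lt hys
  have hsub' : closedBall c s ⊆ Ω := (closedBall_subset_closedBall hsρ.le).trans hsub
  have hzc : ContinuousOn (ballProfile c ρ) (closedBall c s) :=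
    (contDiffOn_ballProfile c hρ).continuousOn.mono (closedBall_subset_ball hsρ)
  have hzs : IsSolution (ball c s) (ballProfile c ρ) :=
    (isSolution_ballProfile c hρ).mono (ball_subset_ball hsρ.le)
  refine hv.le_of_sphere hs0 hsub' hzc hzs (fun x hx => ?_) y ?_
  · have hxs : ‖x - c‖ = s := by rwa [mem_sphere_iff_norm] at hx
    calc v x ≤ K := hK x ((sphere_subset_closedBall.trans (closedBall_subset_closedBall hsρ.le)) hx)
      _ ≤ (2 * ρ / (ρ ^ 2 - s ^ 2)) ^ k := hKs
      _ = ballProfile c ρ x := by rw [ballProfile, hxs]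
  · rwa [mem_ball, dist_eq_norm]

variable (E) in
/-- The LEVEL BOUND `(2R/(R² - (R/2)²))^{(n-2)/2}` = `max` of `u^{(in)}_{R,c}` on `B̄(c, R/2)`.
[folklore] -/
def levelBound (R : ℝ) : ℝ :=
  (2 * R / (R ^ 2 - (R / 2) ^ 2)) ^ (((finrank ℝ E : ℝ) - 2) / 2)

omit [FiniteDimensional ℝ E] in
/-- The ball profile is at most the level bound on the half ball. [folklore] -/
theorem ballProfile_le_levelBound (hn : 3 ≤ finrank ℝ E) {c : E} {R : ℝ} (hR : 0 < R) {y : E}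
    (hy : y ∈ closedBall c (R / 2)) : ballProfile c R y ≤ levelBound E R := by
  have hk0 : 0 ≤ ((finrank ℝ E : ℝ) - 2) / 2 := by
    have : (3 : ℝ) ≤ finrank ℝ E := by exact_mod_cast hn
    linarith
  have hyb : y ∈ ball c R := closedBall_subset_ball (by linarith) hy
  have hyn : ‖y - c‖ ≤ R / 2 := by rwa [mem_closedBall, dist_eq_norm] at hy
  have hsq : ‖y - c‖ ^ 2 ≤ (R / 2) ^ 2 := pow_le_pow_left₀ (norm_nonneg _) hyn 2
  unfold ballProfile levelBound
  refine Real.rpow_le_rpow (ballProfile_base_pos hR hyb).le ?_ hk0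
  refine div_le_div_of_nonneg_left (by linarith) ?_ (by linarith)
  nlinarith

/-- **Uniform local bound of the Perron class**: if `B̄(c, R) ⊆ Ω` then every member is at most
`levelBound E R` on `B̄(c, R/2)`. [cite: GonzalezLiNguyen2018, Lemma 3.1] -/
theorem IsPerron.le_levelBound (hn : 3 ≤ finrank ℝ E) (hv : IsPerron Ω v₀ v) {c : E} {R : ℝ}
    (hR : 0 < R) (hsub : closedBall c R ⊆ Ω) {y : E} (hy : y ∈ closedBall c (R / 2)) :
    v y ≤ levelBound E R :=
  (hv.le_ballProfile hn hR hsub y (closedBall_subset_ball (by linarith) hy)).trans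
    (ballProfile_le_levelBound hn hR hy)

/-! ### The Perron lifting -/

/-- **The Perron lifting stays in the class.** Let `v` be in the Perron class, `B̄(c, r) ⊆ Ω`,
and `z` a solution on `B(c, r)`, continuous on `B̄(c, r)`, with `z = v` on `∂B(c, r)`; then the
function equal to `z` on `B(c, r)` and to `v` elsewhere is in the Perron class (continuity by
pasting; comparison under a solution `z'` on another ball `B'`: `v ≤ z'` on `B'` by the property
of `v`, and `z ≤ z'` on `B ∩ B'` by Prop. 2.2, the boundary inequality holding on `∂B ∩ B̄'`
through `v` and on `B ∩ ∂B'` by hypothesis). [cite: GonzalezLiNguyen2018, proof of Thm. 1.1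
(Step 1)] -/
theorem IsPerron.lift (hn : 3 ≤ finrank ℝ E) (hv : IsPerron Ω v₀ v) {c : E} {r : ℝ}
    (hr : 0 < r) (hsub : closedBall c r ⊆ Ω) {z : E → ℝ} (hzc : ContinuousOn z (closedBall c r))
    (hz : IsSolution (ball c r) z) (hzv : EqOn z v (sphere c r)) :
    IsPerron Ω v₀ ((ball c r).piecewise z v) := by
  -- `v ≤ z` on the ball, hence `v ≤` the lifting everywhere
  have hvz : ∀ y ∈ ball c r, v y ≤ z y :=
    hv.le_of_sphere hr hsub hzc hz fun y hy => (hzv hy).symm.le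
  have hvle : ∀ y, v y ≤ (ball c r).piecewise z v y := fun y => by
    by_cases hy : y ∈ ball c r
    · rw [piecewise_eq_of_mem _ _ _ hy]; exact hvz y hy
    · rw [piecewise_eq_of_notMem _ _ _ hy]
  refine ⟨?_, fun y hy => (hv.floor_le hy).trans (hvle y), ?_⟩
  · refine ContinuousOn.piecewise ?_ (hzc.mono ?_) (hv.continuousOn.mono inter_subset_left)
    · rw [frontier_ball c hr.ne']
      exact fun y hy => hzv hy.2
    · rw [closure_ball c hr.ne']
      exact inter_subset_right
  intro c' r' hr' hsub' z' hz'c hz' hle y hy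
  -- `v ≤ z'` on `B'`
  have h1 : ∀ y ∈ ball c' r', v y ≤ z' y :=
    hv.le_of_sphere hr' hsub' hz'c hz' fun y hy => (hvle y).trans (hle y hy)
  by_cases hyb : y ∈ ball c r
  · rw [piecewise_eq_of_mem _ _ _ hyb]
    -- comparison of `z` and `z'` on `G = B ∩ B'`
    set G : Set E := ball c r ∩ ball c' r' with hG
    have hGo : IsOpen G := isOpen_ball.inter isOpen_ball
    have hGb : IsBounded G := isBounded_ball.subset inter_subset_left
    have hclG : closure G ⊆ closedBall c r ∩ closedBall c' r' :=
      subset_inter ((closure_mono inter_subset_left).trans closure_ball_subset_closedBall)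
        ((closure_mono inter_subset_right).trans closure_ball_subset_closedBall)
    -- on `∂G`, `z ≤ z'`
    have key : ∀ ζ ∈ frontier G, z ζ ≤ z' ζ := by
      intro ζ hζ
      rw [hGo.frontier_eq] at hζ
      obtain ⟨hζ1, hζ2⟩ := hclG hζ.1
      have hζG : ζ ∉ G := hζ.2
      by_cases hζb : ζ ∈ ball c r
      · -- then `ζ ∈ ∂B'`, where the lifting (`= z`) is `≤ z'` by hypothesis
        have hζs' : ζ ∈ sphere c' r' := by
          rw [mem_sphere]
          exact le_antisymm (mem_closedBall.1 hζ2) (not_lt.1 fun h => hζG ⟨hζb, h⟩)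
        have h := hle ζ hζs'
        rwa [piecewise_eq_of_mem _ _ _ hζb] at h
      · -- then `ζ ∈ ∂B`, where `z = v ≤ z'`
        have hζs : ζ ∈ sphere c r := by
          rw [mem_sphere]
          exact le_antisymm (mem_closedBall.1 hζ1) (not_lt.1 fun h => hζb h)
        rw [hzv hζs]
        rcases (mem_closedBall.1 hζ2).lt_or_eq with h | h
        · exact h1 ζ h
        · have h' := hle ζ (mem_sphere.2 h)
          rwa [piecewise_eq_of_notMem _ _ _ hζb] at h'
    refine comparison hn hGo hGb (hz.mono inter_subset_left).isSubsolution
      (hz'.contDiffOn.mono inter_subset_right) (fun x hx => hz'.nonneg hx.2)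
      (fun x hx => (hz'.laplacian_eq hx.2).le) (fun ζ hζ ε hε => ?_) y ⟨hyb, hy⟩
    obtain ⟨hζ1, hζ2⟩ := hclG (frontier_subset_closure hζ)
    have ht : Tendsto (fun x => z x - z' x) (𝓝[G] ζ) (𝓝 (z ζ - z' ζ)) :=
      (((hzc ζ hζ1).mono (inter_subset_left.trans ball_subset_closedBall)).sub
        ((hz'c ζ hζ2).mono (inter_subset_right.trans ball_subset_closedBall))).tendsto
    have hlt : z ζ - z' ζ < ε := by linarith [key ζ hζ]
    exact (ht.eventually_lt_const hlt).mono fun x hx => by linarith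
  · rw [piecewise_eq_of_notMem _ _ _ hyb]
    exact h1 y hy

omit [InnerProductSpace ℝ E] [FiniteDimensional ℝ E] in
/-- The lifting is `z` on the ball. [folklore] -/
theorem piecewise_ball_of_mem {c : E} {r : ℝ} {z v : E → ℝ} {y : E} (hy : y ∈ ball c r) :
    (ball c r).piecewise z v y = z y :=
  piecewise_eq_of_mem _ _ _ hy

end PerronClass

/-! ### The Perron function -/

section PerronFunction

variable {Ω : Set E} {v₀ v : E → ℝ} {x : E} {a : ℝ}

/-- **The Perron function** of `Ω` with floor `v₀`: the pointwise supremum of the Perron class,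
`perron Ω v₀ x = sup {v x | IsPerron Ω v₀ v}` (González–Li–Nguyen 2018, proof of Thm. 1.1,
Step 1: "the supremum of all admissible subsolutions"). [cite: GonzalezLiNguyen2018, proof of
Thm. 1.1 (Step 1)] -/
def perron (Ω : Set E) (v₀ : E → ℝ) (x : E) : ℝ :=
  ⨆ v : {v : E → ℝ // IsPerron Ω v₀ v}, (v : E → ℝ) x

/-- The values of the Perron class at a point of the open set `Ω` are bounded above (by the
ball solutions, Lemma 3.1). [cite: GonzalezLiNguyen2018, Lemma 3.1] -/
theorem bddAbove_range_perron (hn : 3 ≤ finrank ℝ E) (hΩ : IsOpen Ω) (hx : x ∈ Ω) :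
    BddAbove (range fun v : {v : E → ℝ // IsPerron Ω v₀ v} => (v : E → ℝ) x) := by
  obtain ⟨ε, hε, hball⟩ := Metric.isOpen_iff.1 hΩ x hx
  have hR : 0 < ε / 2 := half_pos hε
  have hsub : closedBall x (ε / 2) ⊆ Ω := (closedBall_subset_ball (half_lt_self hε)).trans hball
  refine ⟨ballProfile x (ε / 2) x, ?_⟩
  rintro _ ⟨⟨v, hv⟩, rfl⟩
  exact hv.le_ballProfile hn hR hsub x (mem_ball_self hR)

/-- Members of the Perron class lie below the Perron function on `Ω`. [folklore] -/
theorem IsPerron.le_perron (hn : 3 ≤ finrank ℝ E) (hΩ : IsOpen Ω) (hv : IsPerron Ω v₀ v)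
    (hx : x ∈ Ω) : v x ≤ perron Ω v₀ x :=
  le_ciSup (bddAbove_range_perron hn hΩ hx) (⟨v, hv⟩ : {v : E → ℝ // IsPerron Ω v₀ v})

/-- A pointwise bound of the class bounds the Perron function (the class being nonempty).
[folklore] -/
theorem perron_le (h₀ : IsPerron Ω v₀ v₀) (h : ∀ v, IsPerron Ω v₀ v → v x ≤ a) :
    perron Ω v₀ x ≤ a :=
  haveI : Nonempty {v : E → ℝ // IsPerron Ω v₀ v} := ⟨⟨v₀, h₀⟩⟩
  ciSup_le fun v => h v.1 v.2

/-- Below the Perron function there are members of the class. [folklore] -/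
theorem exists_lt_of_lt_perron (h₀ : IsPerron Ω v₀ v₀) (ha : a < perron Ω v₀ x) :
    ∃ v, IsPerron Ω v₀ v ∧ a < v x := by
  haveI : Nonempty {v : E → ℝ // IsPerron Ω v₀ v} := ⟨⟨v₀, h₀⟩⟩
  obtain ⟨⟨v, hv⟩, h⟩ := exists_lt_of_lt_ciSup ha
  exact ⟨v, hv, h⟩

/-- The floor lies below the Perron function on `Ω`. [folklore] -/
theorem floor_le_perron (hn : 3 ≤ finrank ℝ E) (hΩ : IsOpen Ω) (h₀ : IsPerron Ω v₀ v₀)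
    (hx : x ∈ Ω) : v₀ x ≤ perron Ω v₀ x :=
  h₀.le_perron hn hΩ hx

/-- The Perron function obeys the level bound on half balls. [cite: GonzalezLiNguyen2018,
Lemma 3.1] -/
theorem perron_le_levelBound (hn : 3 ≤ finrank ℝ E) (h₀ : IsPerron Ω v₀ v₀) {c : E} {R : ℝ}
    (hR : 0 < R) (hsub : closedBall c R ⊆ Ω) {y : E} (hy : y ∈ closedBall c (R / 2)) :
    perron Ω v₀ y ≤ levelBound E R :=
  perron_le h₀ fun _ hv => hv.le_levelBound hn hR hsub hy

end PerronFunction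

/-! ### Partial maxima of a sequence of functions -/

section PartialMax

variable {Ω : Set E} {v₀ : E → ℝ}

/-- `partialMax g k = max (g 0, …, g k)` pointwise. [folklore] -/
def partialMax (g : ℕ → E → ℝ) : ℕ → E → ℝ
  | 0 => g 0
  | k + 1 => fun x => max (partialMax g k x) (g (k + 1) x)

omit [NormedAddCommGroup E] [InnerProductSpace ℝ E] [FiniteDimensional ℝ E] in
/-- `partialMax g` is non-decreasing in `k`. [folklore] -/
theorem partialMax_le_succ (g : ℕ → E → ℝ) (k : ℕ) (x : E) :
    partialMax g k x ≤ partialMax g (k + 1) x :=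
  le_max_left _ _

omit [NormedAddCommGroup E] [InnerProductSpace ℝ E] [FiniteDimensional ℝ E] in
/-- `partialMax g` is monotone in `k`. [folklore] -/
theorem partialMax_mono (g : ℕ → E → ℝ) (x : E) : Monotone fun k => partialMax g k x :=
  monotone_nat_of_le_succ fun k => partialMax_le_succ g k x

omit [NormedAddCommGroup E] [InnerProductSpace ℝ E] [FiniteDimensional ℝ E] in
/-- `g j ≤ partialMax g k` for `j ≤ k`. [folklore] -/
theorem le_partialMax (g : ℕ → E → ℝ) {j k : ℕ} (hjk : j ≤ k) (x : E) :
    g j x ≤ partialMax g k x := by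
  induction k with
  | zero =>
    obtain rfl : j = 0 := Nat.le_zero.1 hjk
    exact le_rfl
  | succ k ih =>
    rcases Nat.of_le_succ hjk with h | h
    · exact (ih h).trans (partialMax_le_succ g k x)
    · subst h
      exact le_max_right _ _

/-- Partial maxima of members of the Perron class are members. [folklore] -/
theorem isPerron_partialMax {g : ℕ → E → ℝ} (hg : ∀ j, IsPerron Ω v₀ (g j)) :
    ∀ k, IsPerron Ω v₀ (partialMax g k)
  | 0 => hg 0
  | k + 1 => (isPerron_partialMax hg k).sup (hg (k + 1))

end PartialMax

/-! ### Perron's theorem: the Perron function is a solution -/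

section PerronTheorem

variable {Ω : Set E} {v₀ : E → ℝ}

/-- **Lifting a non-decreasing sequence of the Perron class on a ball** (the core of Perron's
argument).  Setting: `B̄(x₀, R₀) ⊆ Ω`, `0 < δ ≤ v₀` on `B̄(x₀, R₀)`, `M = levelBound E R₀`,
`0 < r ≤ R₀/2`, and the Dirichlet problem on `B(x₀, r)` solvable for continuous data in `[δ, M]`
(hypothesis `solve`).  For a non-decreasing sequence `w k` in the class, the solutions `z k` with
data `w k` on `∂B(x₀, r)` satisfy: `w k ≤ z k ≤ perron` and `δ ≤ z k ≤ M` on the ball, and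
`z k ≤ z (k+1)`. [cite: GonzalezLiNguyen2018, proof of Thm. 1.1 (Step 1)] -/
theorem exists_lifted_sequence (hn : 3 ≤ finrank ℝ E) (hΩ : IsOpen Ω) (h₀ : IsPerron Ω v₀ v₀)
    {x₀ : E} {R₀ δ r : ℝ} (hR₀ : 0 < R₀) (hsub : closedBall x₀ R₀ ⊆ Ω)
    (hv₀δ : ∀ y ∈ closedBall x₀ R₀, δ ≤ v₀ y) (hr : 0 < r) (hrR : r ≤ R₀ / 2)
    (solve : ∀ φ : E → ℝ, ContinuousOn φ (sphere x₀ r) → (∀ y ∈ sphere x₀ r, δ ≤ φ y) →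
      (∀ y ∈ sphere x₀ r, φ y ≤ levelBound E R₀) →
      ∃ z : E → ℝ, ContinuousOn z (closedBall x₀ r) ∧ IsSolution (ball x₀ r) z ∧
        EqOn z φ (sphere x₀ r))
    {w : ℕ → E → ℝ} (hw : ∀ k, IsPerron Ω v₀ (w k)) (hmono : ∀ k y, w k y ≤ w (k + 1) y) :
    ∃ z : ℕ → E → ℝ, (∀ k, ContinuousOn (z k) (closedBall x₀ r)) ∧
      (∀ k, IsSolution (ball x₀ r) (z k)) ∧ (∀ k, EqOn (z k) (w k) (sphere x₀ r)) ∧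
      (∀ k, ∀ y ∈ ball x₀ r, w k y ≤ z k y) ∧
      (∀ k, ∀ y ∈ ball x₀ r, z k y ≤ perron Ω v₀ y) ∧
      (∀ k, ∀ y ∈ ball x₀ r, δ ≤ z k y) ∧
      (∀ k, ∀ y ∈ ball x₀ r, z k y ≤ levelBound E R₀) ∧
      (∀ k, ∀ y ∈ ball x₀ r, z k y ≤ z (k + 1) y) := by
  have hrsub : closedBall x₀ r ⊆ closedBall x₀ (R₀ / 2) := closedBall_subset_closedBall hrR
  have hhalf : closedBall x₀ (R₀ / 2) ⊆ closedBall x₀ R₀ := closedBall_subset_closedBall (by linarith)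
  have hrΩ : closedBall x₀ r ⊆ Ω := (hrsub.trans hhalf).trans hsub
  -- the data `w k` on the sphere are continuous with values in `[δ, M]`
  have hdata : ∀ k, ∃ z : E → ℝ, ContinuousOn z (closedBall x₀ r) ∧ IsSolution (ball x₀ r) z ∧
      EqOn z (w k) (sphere x₀ r) := fun k =>
    solve (w k) ((hw k).continuousOn.mono (sphere_subset_closedBall.trans hrΩ))
      (fun y hy => (hv₀δ y (hhalf (hrsub (sphere_subset_closedBall hy)))).trans
        ((hw k).floor_le (hrΩ (sphere_subset_closedBall hy))))
      fun y hy => (hw k).le_levelBound hn hR₀ hsub (hrsub (sphere_subset_closedBall hy))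
  choose z hzc hz hzw using hdata
  have hwz : ∀ k, ∀ y ∈ ball x₀ r, w k y ≤ z k y := fun k =>
    (hw k).le_of_sphere hr hrΩ (hzc k) (hz k) fun y hy => ((hzw k) hy).symm.le
  have hzp : ∀ k, ∀ y ∈ ball x₀ r, z k y ≤ perron Ω v₀ y := fun k y hy => by
    have h := ((hw k).lift hn hr hrΩ (hzc k) (hz k) (hzw k)).le_perron hn hΩ
      (hrΩ (ball_subset_closedBall hy))
    rwa [piecewise_ball_of_mem hy] at h
  refine ⟨z, hzc, hz, hzw, hwz, hzp, fun k y hy => ?_, fun k y hy => ?_, fun k => ?_⟩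
  · exact ((hv₀δ y (hhalf (hrsub (ball_subset_closedBall hy)))).trans
      ((hw k).floor_le (hrΩ (ball_subset_closedBall hy)))).trans (hwz k y hy)
  · exact (hzp k y hy).trans
      (perron_le_levelBound hn h₀ hR₀ hsub (hrsub (ball_subset_closedBall hy)))
  · exact (hz k).le_of_sphere hn hr (hz (k + 1)) (hzc k) (hzc (k + 1)) fun y hy => by
      rw [hzw k hy, hzw (k + 1) hy]; exact hmono k y

/-- **Perron's theorem for the Loewner–Nirenberg equation** (local form).  Assume the local
solvability `(S)` and the compactness `(K)` (module docstring), `n ≥ 3`, `Ω` open, and let `v₀` be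
a POSITIVE solution on `Ω`.  Then near every point of `Ω` the Perron function `perron Ω v₀`
coincides with a solution. [cite: GonzalezLiNguyen2018, proof of Thm. 1.1 (Step 1)] -/
theorem exists_isSolution_eqOn_perron (hn : 3 ≤ finrank ℝ E)
    (hS : ∀ (c : E) (δ M : ℝ), 0 < δ → δ ≤ M → ∃ r₁ : ℝ, 0 < r₁ ∧ ∀ r : ℝ, 0 < r → r ≤ r₁ →
      ∀ φ : E → ℝ, ContinuousOn φ (sphere c r) → (∀ y ∈ sphere c r, δ ≤ φ y) →
        (∀ y ∈ sphere c r, φ y ≤ M) →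
        ∃ z : E → ℝ, ContinuousOn z (closedBall c r) ∧ IsSolution (ball c r) z ∧
          EqOn z φ (sphere c r))
    (hK : ∀ (c : E) (r r' δ M : ℝ), 0 < r' → r' < r → 0 < δ → ∀ (z : ℕ → E → ℝ) (Z : E → ℝ),
      (∀ k, IsSolution (ball c r) (z k)) → (∀ k, ∀ y ∈ ball c r, δ ≤ z k y) →
        (∀ k, ∀ y ∈ ball c r, z k y ≤ M) → (∀ k, ∀ y ∈ ball c r, z k y ≤ z (k + 1) y) →
        (∀ y ∈ ball c r, Tendsto (fun k => z k y) atTop (𝓝 (Z y))) → IsSolution (ball c r') Z)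
    (hΩ : IsOpen Ω) (hv₀ : IsSolution Ω v₀) (hpos : ∀ x ∈ Ω, 0 < v₀ x) {x₀ : E} (hx₀ : x₀ ∈ Ω) :
    ∃ ρ : ℝ, 0 < ρ ∧ ∃ Z : E → ℝ, IsSolution (ball x₀ ρ) Z ∧
      EqOn (perron Ω v₀) Z (ball x₀ ρ) := by
  have h₀ : IsPerron Ω v₀ v₀ := isPerron_floor hn hv₀
  -- Step 1: a closed ball `B̄(x₀, R₀) ⊆ Ω`, the levels `δ ≤ v₀` there and `M = levelBound E R₀`
  obtain ⟨ε, hε, hball⟩ := Metric.isOpen_iff.1 hΩ x₀ hx₀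
  set R₀ : ℝ := ε / 2 with hR₀def
  have hR₀ : 0 < R₀ := half_pos hε
  have hsub : closedBall x₀ R₀ ⊆ Ω := (closedBall_subset_ball (half_lt_self hε)).trans hball
  obtain ⟨δ, hδ, hv₀δ⟩ : ∃ δ, 0 < δ ∧ ∀ y ∈ closedBall x₀ R₀, δ ≤ v₀ y :=
    (isCompact_closedBall x₀ R₀).exists_forall_le' (hv₀.contDiffOn.continuousOn.mono hsub)
      fun y hy => hpos y (hsub hy)
  set M : ℝ := levelBound E R₀ with hM
  have hδM : δ ≤ M := (hv₀δ x₀ (mem_closedBall_self hR₀.le)).trans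
    (h₀.le_levelBound hn hR₀ hsub (mem_closedBall_self (by positivity)))
  -- Step 2: the radius `r ≤ min (R₀/2) r₁` of the working ball `B = B(x₀, r)`
  obtain ⟨r₁, hr₁, hsolve⟩ := hS x₀ δ M hδ hδM
  set r : ℝ := min (R₀ / 2) r₁ with hrdef
  have hr : 0 < r := lt_min (by positivity) hr₁
  have hrR : r ≤ R₀ / 2 := min_le_left _ _
  have solve := hsolve r hr (min_le_right _ _)
  have hrΩ : closedBall x₀ r ⊆ Ω :=
    ((closedBall_subset_closedBall hrR).trans (closedBall_subset_closedBall (by linarith))).trans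
      hsub
  -- Step 3: a countable dense subset `D = range d` of `B`
  obtain ⟨D, hDB, hDc, hBD⟩ :=
    (IsSeparable.of_separableSpace (ball x₀ r)).exists_countable_dense_subset
  have hDne : D.Nonempty := by
    by_contra h
    rw [not_nonempty_iff_eq_empty] at h
    have := hBD (mem_ball_self hr)
    rw [h, closure_empty] at this
    exact this
  obtain ⟨d, hd⟩ := hDc.exists_eq_range hDne
  have hdB : ∀ i, d i ∈ ball x₀ r := fun i => hDB (hd ▸ mem_range_self i)
  -- Step 4: members `V i m` of the class with `perron (d i) - 1/(m+1) < V i m (d i)`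
  have happrox : ∀ i m : ℕ, ∃ v, IsPerron Ω v₀ v ∧
      perron Ω v₀ (d i) - 1 / ((m : ℝ) + 1) < v (d i) := fun i m =>
    exists_lt_of_lt_perron h₀ (sub_lt_self _ (by positivity))
  choose V hV hVlt using happrox
  -- the non-decreasing sequence `w k = max_{j ≤ k} V (unpair j)` of the class
  set g : ℕ → E → ℝ := fun j => V (Nat.unpair j).1 (Nat.unpair j).2 with hg
  have hgP : ∀ j, IsPerron Ω v₀ (g j) := fun j => hV _ _
  set w : ℕ → E → ℝ := partialMax g with hwdef
  have hw : ∀ k, IsPerron Ω v₀ (w k) := isPerron_partialMax hgP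
  have hwmono : ∀ k y, w k y ≤ w (k + 1) y := fun k y => partialMax_le_succ g k y
  -- the key property of `w`: it exhausts `perron` on `D`
  have hwex : ∀ i m : ℕ, ∀ k, Nat.pair i m ≤ k →
      perron Ω v₀ (d i) - 1 / ((m : ℝ) + 1) < w k (d i) := fun i m k hk => by
    have h1 : g (Nat.pair i m) (d i) ≤ w k (d i) := le_partialMax g hk (d i)
    have h2 : g (Nat.pair i m) = V i m := by simp only [hg, Nat.unpair_pair]
    rw [h2] at h1
    exact (hVlt i m).trans_le h1
  -- Step 5: GENERIC limit construction, for any non-decreasing sequence of the class above `w`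
  have main : ∀ w' : ℕ → E → ℝ, (∀ k, IsPerron Ω v₀ (w' k)) → (∀ k y, w' k y ≤ w' (k + 1) y) →
      (∀ k y, w k y ≤ w' k y) →
      ∃ z : ℕ → E → ℝ, ∃ Z : E → ℝ, (∀ k, ContinuousOn (z k) (closedBall x₀ r)) ∧
        (∀ k, IsSolution (ball x₀ r) (z k)) ∧ (∀ k, EqOn (z k) (w' k) (sphere x₀ r)) ∧
        (∀ k, ∀ y ∈ ball x₀ r, w' k y ≤ z k y) ∧
        (∀ k, ∀ y ∈ ball x₀ r, z k y ≤ Z y) ∧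
        (∀ y ∈ ball x₀ r, Z y ≤ perron Ω v₀ y) ∧
        IsSolution (ball x₀ (r / 2)) Z ∧ (∀ i, d i ∈ ball x₀ (r / 2) → Z (d i) = perron Ω v₀ (d i)) := by
    intro w' hw' hmono' hww'
    obtain ⟨z, hzc, hz, hzw, hwz, hzp, hzδ, hzM, hzmono⟩ :=
      exists_lifted_sequence hn hΩ h₀ hR₀ hsub hv₀δ hr hrR solve hw' hmono'
    -- the pointwise limit `Z`
    have hmono_z : ∀ y ∈ ball x₀ r, Monotone fun k => z k y := fun y hy =>
      monotone_nat_of_le_succ fun k => hzmono k y hy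
    have hbdd_z : ∀ y ∈ ball x₀ r, BddAbove (range fun k => z k y) := fun y hy =>
      ⟨perron Ω v₀ y, by rintro _ ⟨k, rfl⟩; exact hzp k y hy⟩
    set Z : E → ℝ := fun y => ⨆ k, z k y with hZ
    have htend : ∀ y ∈ ball x₀ r, Tendsto (fun k => z k y) atTop (𝓝 (Z y)) := fun y hy =>
      tendsto_atTop_ciSup (hmono_z y hy) (hbdd_z y hy)
    have hzZ : ∀ k, ∀ y ∈ ball x₀ r, z k y ≤ Z y := fun k y hy => le_ciSup (hbdd_z y hy) k
    have hZp : ∀ y ∈ ball x₀ r, Z y ≤ perron Ω v₀ y := fun y hy => ciSup_le fun k => hzp k y hy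
    have hZsol : IsSolution (ball x₀ (r / 2)) Z :=
      hK x₀ r (r / 2) δ M (half_pos hr) (half_lt_self hr) hδ z Z hz hzδ hzM hzmono htend
    refine ⟨z, Z, hzc, hz, hzw, hwz, hzZ, hZp, hZsol, fun i _ => ?_⟩
    -- `Z (d i) = perron (d i)`: `perron (d i) - 1/(m+1) < w (pair i m) (d i) ≤ z _ (d i) ≤ Z (d i)`
    refine le_antisymm (hZp _ (hdB i)) ?_
    by_contra hlt
    rw [not_le] at hlt
    obtain ⟨m, hm⟩ := exists_nat_one_div_lt (sub_pos.2 hlt)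
    have h1 := hwex i m (Nat.pair i m) le_rfl
    have h2 : w (Nat.pair i m) (d i) ≤ Z (d i) :=
      ((hww' _ _).trans (hwz _ _ (hdB i))).trans (hzZ _ _ (hdB i))
    linarith
  -- Step 6: the limit `Z` of the liftings of `w` itself
  obtain ⟨z, Z, hzc, hz, hzw, hwz, hzZ, hZp, hZsol, hZd⟩ := main w hw hwmono fun _ _ => le_rfl
  refine ⟨r / 2, half_pos hr, Z, hZsol, fun y hy => le_antisymm ?_ (hZp y (ball_subset_ball
    (half_le_self hr.le) hy))⟩
  -- Step 7: `perron ≤ Z` on `B(x₀, r/2)`: every member `v` of the class is `≤ Z` there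
  refine perron_le h₀ fun v hv => ?_
  -- the limit `Z'` of the liftings of `max (w k) v`
  obtain ⟨z', Z', hzc', hz', hzw', hwz', hzZ', hZp', hZsol', hZd'⟩ :=
    main (fun k y => max (w k y) (v y)) (fun k => (hw k).sup hv)
      (fun k y => max_le_max (hwmono k y) le_rfl) fun k y => le_max_left _ _
  -- `Z = Z'` on `B(x₀, r/2)`: both are continuous there and agree on the dense `D ∩ B(x₀, r/2)`
  have hB2 : ball x₀ (r / 2) ⊆ ball x₀ r := ball_subset_ball (half_le_self hr.le)
  have heq : EqOn Z Z' (ball x₀ (r / 2)) := by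
    refine EqOn.of_subset_closure (s := D ∩ ball x₀ (r / 2)) ?_
      hZsol.contDiffOn.continuousOn hZsol'.contDiffOn.continuousOn inter_subset_right ?_
    · rintro _ ⟨hyD, hy2⟩
      rw [hd] at hyD
      obtain ⟨i, rfl⟩ := hyD
      rw [hZd i hy2, hZd' i hy2]
    · intro y hy
      rw [inter_comm]
      exact isOpen_ball.inter_closure ⟨hy, hBD (hB2 hy)⟩
  -- `v ≤ max (w 0) v ≤ z' 0 ≤ Z' = Z`
  calc v y ≤ max (w 0 y) (v y) := le_max_right _ _
    _ ≤ z' 0 y := hwz' 0 y (hB2 hy)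
    _ ≤ Z' y := hzZ' 0 y (hB2 hy)
    _ = Z y := (heq hy).symm

/-- **Perron's theorem for the Loewner–Nirenberg equation.**  Under `(S)` and `(K)`, for `n ≥ 3`,
`Ω` open and `v₀` a positive solution on `Ω`, the Perron function `perron Ω v₀` is a solution on
`Ω` (being a solution is a local property). [cite: GonzalezLiNguyen2018, proof of Thm. 1.1
(Step 1)] -/
theorem isSolution_perron (hn : 3 ≤ finrank ℝ E)
    (hS : ∀ (c : E) (δ M : ℝ), 0 < δ → δ ≤ M → ∃ r₁ : ℝ, 0 < r₁ ∧ ∀ r : ℝ, 0 < r → r ≤ r₁ →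
      ∀ φ : E → ℝ, ContinuousOn φ (sphere c r) → (∀ y ∈ sphere c r, δ ≤ φ y) →
        (∀ y ∈ sphere c r, φ y ≤ M) →
        ∃ z : E → ℝ, ContinuousOn z (closedBall c r) ∧ IsSolution (ball c r) z ∧
          EqOn z φ (sphere c r))
    (hK : ∀ (c : E) (r r' δ M : ℝ), 0 < r' → r' < r → 0 < δ → ∀ (z : ℕ → E → ℝ) (Z : E → ℝ),
      (∀ k, IsSolution (ball c r) (z k)) → (∀ k, ∀ y ∈ ball c r, δ ≤ z k y) →
        (∀ k, ∀ y ∈ ball c r, z k y ≤ M) → (∀ k, ∀ y ∈ ball c r, z k y ≤ z (k + 1) y) →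
        (∀ y ∈ ball c r, Tendsto (fun k => z k y) atTop (𝓝 (Z y))) → IsSolution (ball c r') Z)
    (hΩ : IsOpen Ω) (hv₀ : IsSolution Ω v₀) (hpos : ∀ x ∈ Ω, 0 < v₀ x) :
    IsSolution Ω (perron Ω v₀) := by
  have h₀ : IsPerron Ω v₀ v₀ := isPerron_floor hn hv₀
  have hloc : ∀ x ∈ Ω, ∃ Z : E → ℝ, perron Ω v₀ =ᶠ[𝓝 x] Z ∧ perron Ω v₀ x = Z x ∧
      ContDiffAt ℝ 2 Z x ∧ (Δ Z) x = nonlinearity (finrank ℝ E) (Z x) := by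
    intro x hx
    obtain ⟨ρ, hρ, Z, hZ, heq⟩ := exists_isSolution_eqOn_perron hn hS hK hΩ hv₀ hpos hx
    have hxB : x ∈ ball x ρ := mem_ball_self hρ
    exact ⟨Z, eventuallyEq_of_mem (isOpen_ball.mem_nhds hxB) heq, heq hxB,
      (hZ.contDiffOn x hxB).contDiffAt (isOpen_ball.mem_nhds hxB), hZ.laplacian_eq hxB⟩
  refine ⟨fun x hx => ?_, fun x hx => ?_, fun x hx => ?_⟩
  · obtain ⟨Z, hev, -, hZ2, -⟩ := hloc x hx
    exact (hZ2.congr_of_eventuallyEq hev).contDiffWithinAt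
  · exact (hv₀.nonneg hx).trans (floor_le_perron hn hΩ h₀ hx)
  · obtain ⟨Z, hev, hxZ, -, hΔ⟩ := hloc x hx
    rw [(InnerProductSpace.laplacian_congr_nhds hev).eq_of_nhds, hxZ]
    exact hΔ

/-- **Every solution lies below the Perron function** (on `Ω` open, `n ≥ 3`): `max(w, v₀)` is
in the class. [cite: GonzalezLiNguyen2018, proof of Thm. 1.1 (Step 1)] -/
theorem IsSolution.le_perron {w : E → ℝ} (hw : IsSolution Ω w) (hn : 3 ≤ finrank ℝ E)
    (hΩ : IsOpen Ω) (hv₀ : IsSolution Ω v₀) {x : E} (hx : x ∈ Ω) : w x ≤ perron Ω v₀ x :=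
  (le_max_left (w x) (v₀ x)).trans ((isPerron_max_of_isSolution hn hv₀ hw).le_perron hn hΩ hx)

/-! ### F1 from `(S)` and `(K)` -/

/-- **`u_Ω` solves the Loewner–Nirenberg equation** on every open `Ω` with `ℝⁿ ∖ Ω̄ ≠ ∅`,
`n ≥ 3`, granted the local solvability `(S)` and the compactness `(K)`: with the exterior-ball
solution `u^{(out)}_{R,c}` of Lemma 3.2 (`B̄(c, R) ⊆ ℝⁿ ∖ Ω̄`) as positive floor, the Perron
function is a solution dominating every solution, hence equal to `u_Ω` (Def. 4.1: `u_Ω` is the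
largest solution). [cite: GonzalezLiNguyen2018, Def. 4.1 and proof of Thm. 1.1 (Step 1)] -/
theorem isSolution_loewnerNirenberg_of_perron (hn : 3 ≤ finrank ℝ E)
    (hS : ∀ (c : E) (δ M : ℝ), 0 < δ → δ ≤ M → ∃ r₁ : ℝ, 0 < r₁ ∧ ∀ r : ℝ, 0 < r → r ≤ r₁ →
      ∀ φ : E → ℝ, ContinuousOn φ (sphere c r) → (∀ y ∈ sphere c r, δ ≤ φ y) →
        (∀ y ∈ sphere c r, φ y ≤ M) →
        ∃ z : E → ℝ, ContinuousOn z (closedBall c r) ∧ IsSolution (ball c r) z ∧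
          EqOn z φ (sphere c r))
    (hK : ∀ (c : E) (r r' δ M : ℝ), 0 < r' → r' < r → 0 < δ → ∀ (z : ℕ → E → ℝ) (Z : E → ℝ),
      (∀ k, IsSolution (ball c r) (z k)) → (∀ k, ∀ y ∈ ball c r, δ ≤ z k y) →
        (∀ k, ∀ y ∈ ball c r, z k y ≤ M) → (∀ k, ∀ y ∈ ball c r, z k y ≤ z (k + 1) y) →
        (∀ y ∈ ball c r, Tendsto (fun k => z k y) atTop (𝓝 (Z y))) → IsSolution (ball c r') Z)
    {Ω : Set E} (hΩ : IsOpen Ω) (hext : (closure Ω)ᶜ.Nonempty) :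
    IsSolution Ω (loewnerNirenberg Ω) := by
  -- the positive floor: an exterior-ball solution `u^{(out)}_{ε/2, c}`, `B(c, ε) ⊆ ℝⁿ ∖ Ω̄`
  obtain ⟨c, hc⟩ := hext
  obtain ⟨ε, hε, hball⟩ := Metric.isOpen_iff.1 isClosed_closure.isOpen_compl c hc
  have hR : 0 < ε / 2 := half_pos hε
  have hsub : Ω ⊆ (closedBall c (ε / 2))ᶜ := by
    intro y hy hy'
    exact hball (closedBall_subset_ball (half_lt_self hε) hy') (subset_closure hy)
  have hv₀ : IsSolution Ω (exteriorProfile c (ε / 2)) := (isSolution_exteriorProfile c hR).mono hsub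
  have hpos : ∀ x ∈ Ω, 0 < exteriorProfile c (ε / 2) x := fun x hx => exteriorProfile_pos hR (hsub hx)
  have hP := isSolution_perron hn hS hK hΩ hv₀ hpos
  -- `perron = u_Ω` on `Ω`
  refine hP.congr hΩ fun x hx => le_antisymm (loewnerNirenberg_le fun w hw => ?_)
    (hP.le_loewnerNirenberg_of_isOpen hn hΩ hx)
  exact hw.le_perron hn hΩ hv₀ hx

/-- **F1 from `(S)` and `(K)`**: granted local solvability on small balls and compactness of
bounded monotone sequences of solutions, every domain `Ω ⊆ ℝⁿ`, `n ≥ 3`, with `ℝⁿ ∖ Ω̄ ≠ ∅`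
carries a positive maximal solution of the Loewner–Nirenberg equation, namely `u_Ω`
(`exists_isMaximalSolution_iff`). [cite: GonzalezLiNguyen2018, Def. 4.1] -/
theorem exists_isMaximalSolution_of_perron
    (hS : 3 ≤ finrank ℝ E → ∀ (c : E) (δ M : ℝ), 0 < δ → δ ≤ M → ∃ r₁ : ℝ, 0 < r₁ ∧
      ∀ r : ℝ, 0 < r → r ≤ r₁ →
      ∀ φ : E → ℝ, ContinuousOn φ (sphere c r) → (∀ y ∈ sphere c r, δ ≤ φ y) →
        (∀ y ∈ sphere c r, φ y ≤ M) →
        ∃ z : E → ℝ, ContinuousOn z (closedBall c r) ∧ IsSolution (ball c r) z ∧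
          EqOn z φ (sphere c r))
    (hK : 3 ≤ finrank ℝ E → ∀ (c : E) (r r' δ M : ℝ), 0 < r' → r' < r → 0 < δ →
      ∀ (z : ℕ → E → ℝ) (Z : E → ℝ),
      (∀ k, IsSolution (ball c r) (z k)) → (∀ k, ∀ y ∈ ball c r, δ ≤ z k y) →
        (∀ k, ∀ y ∈ ball c r, z k y ≤ M) → (∀ k, ∀ y ∈ ball c r, z k y ≤ z (k + 1) y) →
        (∀ y ∈ ball c r, Tendsto (fun k => z k y) atTop (𝓝 (Z y))) → IsSolution (ball c r') Z) :
    exists_isMaximalSolution (E := E) :=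
  exists_isMaximalSolution_of_isSolution fun _ hn hΩ _ hext =>
    isSolution_loewnerNirenberg_of_perron hn (hS hn) (hK hn) hΩ hext

end PerronTheorem

end LoewnerNirenberg

end Literature.Analysis.PDE
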